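import Summits.ValiantsHypothesis.ValiantsHypothesis.Theorems.KPlusLogSqLawStaticTridiagonalFourByFour

/-!
# Sharp four-by-four law, Part 9a: monomial-ratio monotonicity and the ROOT IDENTITY `(1 − U)(1 − V) = W` of an irreducible `4 × 4` design

HONEST FRAMING.  Helper theorems (`--supports stmt-ValiantsHypothesis-19561 --as helper`; seat val-sym-lift-p2 g9, cell `pub-symmetroid`, 2026-08-27) on the REAL side of the desk's typed α target (lead R2102/R2114), size `m = 4`: the SHARP all-designs value `B 4 = 3` (Part 6 gave `≤ 4` from the two class laws alone).  This part: pointwise algebra at a positive determinant zero.  Nothing here bears on `WeakLifting` (stmt-19561) / `TropicalB` (stmt-19771) in their windows, Conjecture B,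
the Door-A registers, `MatrixDescartes` (stmt-ValiantsHypothesis-18050) or VP ≠ VNP; α status NO MOVER (calibration row at one size).

WHAT IS PROVED.  `pow_mul_pow_lt_of_lt`, `monomialRatio_compare` (a ratio of monomials `α t^p/(β t^q)` is strictly increasing / decreasing / constant according to `p` vs `q`); `four_root_facts` (at a positive zero of an irreducible `4 × 4` design: `(1 − U)(1 − V) = W` for the normalised link weights `U = w₀/(d₀d₁)`, `W = w₁/(d₁d₂)`, `V = w₂/(d₂d₃)`; bottom class ⟺ `U < 1`; `K₂ ≠ 0`, `K₃K₂ > 0`); `four_card_filter_U_lt_one_le_two`, `four_card_filter_one_lt_U_le_two` (the zeros with `U < 1`, resp. `U > 1`, are bottom-, resp. top-class, hence ≤ 2 each by Parts 2/3b). [this file; Parts 2–6 of this seat]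
-/

set_option linter.dupNamespace false
set_option autoImplicit false

namespace Summit.ValiantsHypothesis.ValiantsHypothesis.Theorems.KPlusLogSqLaw.DefiniteInterpolation

open Summit.ValiantsHypothesis.ValiantsHypothesis.Theorems.ValuativeFlip (ctK ctK_zero ctK_one ctK_two ctK_add_two)
open Polynomial


/-! ### Two monomials compared at two points -/

/-- `t^p · t'^q < t'^p · t^q` for `0 < t < t'` and `q < p`. [folklore] -/
theorem pow_mul_pow_lt_of_lt {t t' : ℝ} (ht : 0 < t) (htt' : t < t') {p q : ℕ} (hpq : q < p) :
    t ^ p * t' ^ q < t' ^ p * t ^ q := by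
  obtain ⟨k, rfl⟩ := Nat.exists_eq_add_of_lt hpq
  have ht' : 0 < t' := ht.trans htt'
  have hk : t ^ (k + 1) < t' ^ (k + 1) := pow_lt_pow_left₀ htt' ht.le (Nat.succ_ne_zero k)
  have : t ^ (q + k + 1) * t' ^ q = (t ^ q * t' ^ q) * t ^ (k + 1) := by ring
  have : t' ^ (q + k + 1) * t ^ q = (t ^ q * t' ^ q) * t' ^ (k + 1) := by ring
  nlinarith [mul_pos (pow_pos ht q) (pow_pos ht' q)]

/-- A ratio of monomials `α t^p / (β t^q)` (`α, β > 0`) is strictly increasing on `t > 0` when `q < p`, strictly decreasing when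
`p < q`, constant when `p = q`. [folklore] -/
theorem monomialRatio_compare {α β t t' : ℝ} (hα : 0 < α) (hβ : 0 < β) (ht : 0 < t) (htt' : t < t') (p q : ℕ) :
    (q < p → α * t ^ p / (β * t ^ q) < α * t' ^ p / (β * t' ^ q)) ∧
    (p < q → α * t' ^ p / (β * t' ^ q) < α * t ^ p / (β * t ^ q)) ∧
    (p = q → α * t ^ p / (β * t ^ q) = α * t' ^ p / (β * t' ^ q)) := by
  have ht' : 0 < t' := ht.trans htt'
  refine ⟨fun h => ?_, fun h => ?_, fun h => ?_⟩
  · rw [div_lt_div_iff₀ (mul_pos hβ (pow_pos ht q)) (mul_pos hβ (pow_pos ht' q))]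
    have := pow_mul_pow_lt_of_lt ht htt' h
    nlinarith [mul_pos hα hβ]
  · rw [div_lt_div_iff₀ (mul_pos hβ (pow_pos ht' q)) (mul_pos hβ (pow_pos ht q))]
    have := pow_mul_pow_lt_of_lt ht htt' h
    nlinarith [mul_pos hα hβ]
  · subst h
    rw [mul_div_mul_right _ _ (pow_ne_zero _ ht.ne'), mul_div_mul_right _ _ (pow_ne_zero _ ht'.ne')]

/-! ### The sharp four-by-four law -/

/-- **Root facts for an irreducible `4 × 4` design** (pointwise, at a positive determinant zero `t`): with the normalised link
weights `U = w₀/(d₀d₁)`, `W = w₁/(d₁d₂)`, `V = w₂/(d₂d₃)` one has `(1 − U)(1 − V) = W`; the zero is in the bottom class (`K₂ > 0`) iff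
`U < 1`; `K₂ ≠ 0` and `K₃ K₂ > 0`. [this file] -/
theorem four_root_facts (c : Fin 4 → Fin 4 → ℝ) (e : Fin 4 → Fin 4 → ℕ) (hc : ∀ i j, c i j = c j i)
    (hband : ∀ i j : Fin 4, (i : ℕ) + 1 < j ∨ (j : ℕ) + 1 < i → c i j = 0) (hpos : ∀ i, 0 < c i i)
    (hirr : ∀ (k : ℕ) (hk : k + 1 < 4), c ⟨k, by omega⟩ ⟨k + 1, hk⟩ ≠ 0) {t : ℝ} (ht : 0 < t)
    (hroot : (Matrix.det (Matrix.of fun i j => C (c i j) * (X : ℝ[X]) ^ e i j)).IsRoot t) :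
    (1 - (c ⟨0, by omega⟩ ⟨1, by omega⟩ * c ⟨1, by omega⟩ ⟨0, by omega⟩) * t ^ (e ⟨0, by omega⟩ ⟨1, by omega⟩ + e ⟨1, by omega⟩ ⟨0, by omega⟩) / ((c ⟨0, by omega⟩ ⟨0, by omega⟩ * c ⟨1, by omega⟩ ⟨1, by omega⟩) * t ^ (e ⟨0, by omega⟩ ⟨0, by omega⟩ + e ⟨1, by omega⟩ ⟨1, by omega⟩))) *
        (1 - (c ⟨2, by omega⟩ ⟨3, by omega⟩ * c ⟨3, by omega⟩ ⟨2, by omega⟩) * t ^ (e ⟨2, by omega⟩ ⟨3, by omega⟩ + e ⟨3, by omega⟩ ⟨2, by omega⟩) / ((c ⟨2, by omega⟩ ⟨2, by omega⟩ * c ⟨3, by omega⟩ ⟨3, by omega⟩) * t ^ (e ⟨2, by omega⟩ ⟨2, by omega⟩ + e ⟨3, by omega⟩ ⟨3, by omega⟩))) =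
      (c ⟨1, by omega⟩ ⟨2, by omega⟩ * c ⟨2, by omega⟩ ⟨1, by omega⟩) * t ^ (e ⟨1, by omega⟩ ⟨2, by omega⟩ + e ⟨2, by omega⟩ ⟨1, by omega⟩) / ((c ⟨1, by omega⟩ ⟨1, by omega⟩ * c ⟨2, by omega⟩ ⟨2, by omega⟩) * t ^ (e ⟨1, by omega⟩ ⟨1, by omega⟩ + e ⟨2, by omega⟩ ⟨2, by omega⟩)) ∧
    (0 < ctK (fun s : ℕ => if h : s < 4 then c ⟨s, h⟩ ⟨s, h⟩ * t ^ e ⟨s, h⟩ ⟨s, h⟩ else 1)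
          (fun s : ℕ => -(if h : s + 1 < 4 then c ⟨s, by omega⟩ ⟨s + 1, h⟩ * t ^ e ⟨s, by omega⟩ ⟨s + 1, h⟩ else 0))
          (fun s : ℕ => if h : 1 ≤ s ∧ s < 4 then c ⟨s, h.2⟩ ⟨s - 1, by omega⟩ * t ^ e ⟨s, h.2⟩ ⟨s - 1, by omega⟩ else 0) 2 ↔
      (c ⟨0, by omega⟩ ⟨1, by omega⟩ * c ⟨1, by omega⟩ ⟨0, by omega⟩) * t ^ (e ⟨0, by omega⟩ ⟨1, by omega⟩ + e ⟨1, by omega⟩ ⟨0, by omega⟩) / ((c ⟨0, by omega⟩ ⟨0, by omega⟩ * c ⟨1, by omega⟩ ⟨1, by omega⟩) * t ^ (e ⟨0, by omega⟩ ⟨0, by omega⟩ + e ⟨1, by omega⟩ ⟨1, by omega⟩)) < 1) ∧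
    ctK (fun s : ℕ => if h : s < 4 then c ⟨s, h⟩ ⟨s, h⟩ * t ^ e ⟨s, h⟩ ⟨s, h⟩ else 1)
          (fun s : ℕ => -(if h : s + 1 < 4 then c ⟨s, by omega⟩ ⟨s + 1, h⟩ * t ^ e ⟨s, by omega⟩ ⟨s + 1, h⟩ else 0))
          (fun s : ℕ => if h : 1 ≤ s ∧ s < 4 then c ⟨s, h.2⟩ ⟨s - 1, by omega⟩ * t ^ e ⟨s, h.2⟩ ⟨s - 1, by omega⟩ else 0) 2 ≠ 0 ∧
    0 < ctK (fun s : ℕ => if h : s < 4 then c ⟨s, h⟩ ⟨s, h⟩ * t ^ e ⟨s, h⟩ ⟨s, h⟩ else 1)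
          (fun s : ℕ => -(if h : s + 1 < 4 then c ⟨s, by omega⟩ ⟨s + 1, h⟩ * t ^ e ⟨s, by omega⟩ ⟨s + 1, h⟩ else 0))
          (fun s : ℕ => if h : 1 ≤ s ∧ s < 4 then c ⟨s, h.2⟩ ⟨s - 1, by omega⟩ * t ^ e ⟨s, h.2⟩ ⟨s - 1, by omega⟩ else 0) 3 *
      ctK (fun s : ℕ => if h : s < 4 then c ⟨s, h⟩ ⟨s, h⟩ * t ^ e ⟨s, h⟩ ⟨s, h⟩ else 1)
          (fun s : ℕ => -(if h : s + 1 < 4 then c ⟨s, by omega⟩ ⟨s + 1, h⟩ * t ^ e ⟨s, by omega⟩ ⟨s + 1, h⟩ else 0))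
          (fun s : ℕ => if h : 1 ≤ s ∧ s < 4 then c ⟨s, h.2⟩ ⟨s - 1, by omega⟩ * t ^ e ⟨s, h.2⟩ ⟨s - 1, by omega⟩ else 0) 2 := by
  have hw1 : 0 < c ⟨1, by omega⟩ ⟨2, by omega⟩ * c ⟨2, by omega⟩ ⟨1, by omega⟩ := by rw [hc ⟨2, by omega⟩]; exact mul_self_pos.mpr (hirr 1 (by omega))
  have hd01 : 0 < c ⟨0, by omega⟩ ⟨0, by omega⟩ * c ⟨1, by omega⟩ ⟨1, by omega⟩ := mul_pos (hpos _) (hpos _)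
  have hd12 : 0 < c ⟨1, by omega⟩ ⟨1, by omega⟩ * c ⟨2, by omega⟩ ⟨2, by omega⟩ := mul_pos (hpos _) (hpos _)
  have hd23 : 0 < c ⟨2, by omega⟩ ⟨2, by omega⟩ * c ⟨3, by omega⟩ ⟨3, by omega⟩ := mul_pos (hpos _) (hpos _)
  have hL : ∀ (s : ℕ) (hs : s < 4), (fun s : ℕ => if h : s < 4 then c ⟨s, h⟩ ⟨s, h⟩ * t ^ e ⟨s, h⟩ ⟨s, h⟩ else 1) s =
      c ⟨s, hs⟩ ⟨s, hs⟩ * t ^ e ⟨s, hs⟩ ⟨s, hs⟩ := fun s hs => by simp only [dif_pos hs]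
  have hMN : ∀ (s : ℕ) (hs : s + 1 < 4), (fun s : ℕ => -(if h : s + 1 < 4 then c ⟨s, by omega⟩ ⟨s + 1, h⟩ * t ^ e ⟨s, by omega⟩ ⟨s + 1, h⟩ else 0)) s *
      (fun s : ℕ => if h : 1 ≤ s ∧ s < 4 then c ⟨s, h.2⟩ ⟨s - 1, by omega⟩ * t ^ e ⟨s, h.2⟩ ⟨s - 1, by omega⟩ else 0) (s + 1) =
      -(c ⟨s, by omega⟩ ⟨s + 1, hs⟩ * c ⟨s + 1, hs⟩ ⟨s, by omega⟩ *
        t ^ (e ⟨s, by omega⟩ ⟨s + 1, hs⟩ + e ⟨s + 1, hs⟩ ⟨s, by omega⟩)) := by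
    intro s hs
    have hw := linkWeight_eq c e t s
    rw [dif_pos hs] at hw
    linarith
  have h4 : ctK (fun s : ℕ => if h : s < 4 then c ⟨s, h⟩ ⟨s, h⟩ * t ^ e ⟨s, h⟩ ⟨s, h⟩ else 1)
        (fun s : ℕ => -(if h : s + 1 < 4 then c ⟨s, by omega⟩ ⟨s + 1, h⟩ * t ^ e ⟨s, by omega⟩ ⟨s + 1, h⟩ else 0))
        (fun s : ℕ => if h : 1 ≤ s ∧ s < 4 then c ⟨s, h.2⟩ ⟨s - 1, by omega⟩ * t ^ e ⟨s, h.2⟩ ⟨s - 1, by omega⟩ else 0) 4 =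
      (fun s : ℕ => if h : s < 4 then c ⟨s, h⟩ ⟨s, h⟩ * t ^ e ⟨s, h⟩ ⟨s, h⟩ else 1) 3 * ctK (fun s : ℕ => if h : s < 4 then c ⟨s, h⟩ ⟨s, h⟩ * t ^ e ⟨s, h⟩ ⟨s, h⟩ else 1)
        (fun s : ℕ => -(if h : s + 1 < 4 then c ⟨s, by omega⟩ ⟨s + 1, h⟩ * t ^ e ⟨s, by omega⟩ ⟨s + 1, h⟩ else 0))
        (fun s : ℕ => if h : 1 ≤ s ∧ s < 4 then c ⟨s, h.2⟩ ⟨s - 1, by omega⟩ * t ^ e ⟨s, h.2⟩ ⟨s - 1, by omega⟩ else 0) 3 +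
      (fun s : ℕ => -(if h : s + 1 < 4 then c ⟨s, by omega⟩ ⟨s + 1, h⟩ * t ^ e ⟨s, by omega⟩ ⟨s + 1, h⟩ else 0)) 2 * (fun s : ℕ => if h : 1 ≤ s ∧ s < 4 then c ⟨s, h.2⟩ ⟨s - 1, by omega⟩ * t ^ e ⟨s, h.2⟩ ⟨s - 1, by omega⟩ else 0) (2 + 1) * ctK (fun s : ℕ => if h : s < 4 then c ⟨s, h⟩ ⟨s, h⟩ * t ^ e ⟨s, h⟩ ⟨s, h⟩ else 1)
        (fun s : ℕ => -(if h : s + 1 < 4 then c ⟨s, by omega⟩ ⟨s + 1, h⟩ * t ^ e ⟨s, by omega⟩ ⟨s + 1, h⟩ else 0))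
        (fun s : ℕ => if h : 1 ≤ s ∧ s < 4 then c ⟨s, h.2⟩ ⟨s - 1, by omega⟩ * t ^ e ⟨s, h.2⟩ ⟨s - 1, by omega⟩ else 0) 2 := ctK_add_two _ _ _ 2
  have h3 : ctK (fun s : ℕ => if h : s < 4 then c ⟨s, h⟩ ⟨s, h⟩ * t ^ e ⟨s, h⟩ ⟨s, h⟩ else 1)
        (fun s : ℕ => -(if h : s + 1 < 4 then c ⟨s, by omega⟩ ⟨s + 1, h⟩ * t ^ e ⟨s, by omega⟩ ⟨s + 1, h⟩ else 0))
        (fun s : ℕ => if h : 1 ≤ s ∧ s < 4 then c ⟨s, h.2⟩ ⟨s - 1, by omega⟩ * t ^ e ⟨s, h.2⟩ ⟨s - 1, by omega⟩ else 0) 3 =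
      (fun s : ℕ => if h : s < 4 then c ⟨s, h⟩ ⟨s, h⟩ * t ^ e ⟨s, h⟩ ⟨s, h⟩ else 1) 2 * ctK (fun s : ℕ => if h : s < 4 then c ⟨s, h⟩ ⟨s, h⟩ * t ^ e ⟨s, h⟩ ⟨s, h⟩ else 1)
        (fun s : ℕ => -(if h : s + 1 < 4 then c ⟨s, by omega⟩ ⟨s + 1, h⟩ * t ^ e ⟨s, by omega⟩ ⟨s + 1, h⟩ else 0))
        (fun s : ℕ => if h : 1 ≤ s ∧ s < 4 then c ⟨s, h.2⟩ ⟨s - 1, by omega⟩ * t ^ e ⟨s, h.2⟩ ⟨s - 1, by omega⟩ else 0) 2 +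
      (fun s : ℕ => -(if h : s + 1 < 4 then c ⟨s, by omega⟩ ⟨s + 1, h⟩ * t ^ e ⟨s, by omega⟩ ⟨s + 1, h⟩ else 0)) 1 * (fun s : ℕ => if h : 1 ≤ s ∧ s < 4 then c ⟨s, h.2⟩ ⟨s - 1, by omega⟩ * t ^ e ⟨s, h.2⟩ ⟨s - 1, by omega⟩ else 0) (1 + 1) * ctK (fun s : ℕ => if h : s < 4 then c ⟨s, h⟩ ⟨s, h⟩ * t ^ e ⟨s, h⟩ ⟨s, h⟩ else 1)
        (fun s : ℕ => -(if h : s + 1 < 4 then c ⟨s, by omega⟩ ⟨s + 1, h⟩ * t ^ e ⟨s, by omega⟩ ⟨s + 1, h⟩ else 0))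
        (fun s : ℕ => if h : 1 ≤ s ∧ s < 4 then c ⟨s, h.2⟩ ⟨s - 1, by omega⟩ * t ^ e ⟨s, h.2⟩ ⟨s - 1, by omega⟩ else 0) 1 := ctK_add_two _ _ _ 1
  have h2 : ctK (fun s : ℕ => if h : s < 4 then c ⟨s, h⟩ ⟨s, h⟩ * t ^ e ⟨s, h⟩ ⟨s, h⟩ else 1)
        (fun s : ℕ => -(if h : s + 1 < 4 then c ⟨s, by omega⟩ ⟨s + 1, h⟩ * t ^ e ⟨s, by omega⟩ ⟨s + 1, h⟩ else 0))
        (fun s : ℕ => if h : 1 ≤ s ∧ s < 4 then c ⟨s, h.2⟩ ⟨s - 1, by omega⟩ * t ^ e ⟨s, h.2⟩ ⟨s - 1, by omega⟩ else 0) 2 =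
      (fun s : ℕ => if h : s < 4 then c ⟨s, h⟩ ⟨s, h⟩ * t ^ e ⟨s, h⟩ ⟨s, h⟩ else 1) 1 * (fun s : ℕ => if h : s < 4 then c ⟨s, h⟩ ⟨s, h⟩ * t ^ e ⟨s, h⟩ ⟨s, h⟩ else 1) 0 +
      (fun s : ℕ => -(if h : s + 1 < 4 then c ⟨s, by omega⟩ ⟨s + 1, h⟩ * t ^ e ⟨s, by omega⟩ ⟨s + 1, h⟩ else 0)) 0 * (fun s : ℕ => if h : 1 ≤ s ∧ s < 4 then c ⟨s, h.2⟩ ⟨s - 1, by omega⟩ * t ^ e ⟨s, h.2⟩ ⟨s - 1, by omega⟩ else 0) (0 + 1) :=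
    ctK_two _ _ _
  have h1 : ctK (fun s : ℕ => if h : s < 4 then c ⟨s, h⟩ ⟨s, h⟩ * t ^ e ⟨s, h⟩ ⟨s, h⟩ else 1)
        (fun s : ℕ => -(if h : s + 1 < 4 then c ⟨s, by omega⟩ ⟨s + 1, h⟩ * t ^ e ⟨s, by omega⟩ ⟨s + 1, h⟩ else 0))
        (fun s : ℕ => if h : 1 ≤ s ∧ s < 4 then c ⟨s, h.2⟩ ⟨s - 1, by omega⟩ * t ^ e ⟨s, h.2⟩ ⟨s - 1, by omega⟩ else 0) 1 = (fun s : ℕ => if h : s < 4 then c ⟨s, h⟩ ⟨s, h⟩ * t ^ e ⟨s, h⟩ ⟨s, h⟩ else 1) 0 := ctK_one _ _ _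
  have hz : ctK (fun s : ℕ => if h : s < 4 then c ⟨s, h⟩ ⟨s, h⟩ * t ^ e ⟨s, h⟩ ⟨s, h⟩ else 1)
        (fun s : ℕ => -(if h : s + 1 < 4 then c ⟨s, by omega⟩ ⟨s + 1, h⟩ * t ^ e ⟨s, by omega⟩ ⟨s + 1, h⟩ else 0))
        (fun s : ℕ => if h : 1 ≤ s ∧ s < 4 then c ⟨s, h.2⟩ ⟨s - 1, by omega⟩ * t ^ e ⟨s, h.2⟩ ⟨s - 1, by omega⟩ else 0) 4 = 0 := (isRoot_iff_ctK_eq_zero c e hband t).mp hroot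
  have h32 := ctK_mul_pos_of_root c e hc hpos hirr ht 2 rfl hz
  -- closed forms of K2, K3 and the root equation
  have eK2 : ctK (fun s : ℕ => if h : s < 4 then c ⟨s, h⟩ ⟨s, h⟩ * t ^ e ⟨s, h⟩ ⟨s, h⟩ else 1)
        (fun s : ℕ => -(if h : s + 1 < 4 then c ⟨s, by omega⟩ ⟨s + 1, h⟩ * t ^ e ⟨s, by omega⟩ ⟨s + 1, h⟩ else 0))
        (fun s : ℕ => if h : 1 ≤ s ∧ s < 4 then c ⟨s, h.2⟩ ⟨s - 1, by omega⟩ * t ^ e ⟨s, h.2⟩ ⟨s - 1, by omega⟩ else 0) 2 = c ⟨1, by omega⟩ ⟨1, by omega⟩ * t ^ e ⟨1, by omega⟩ ⟨1, by omega⟩ * (c ⟨0, by omega⟩ ⟨0, by omega⟩ * t ^ e ⟨0, by omega⟩ ⟨0, by omega⟩) +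
      -(c ⟨0, by omega⟩ ⟨1, by omega⟩ * c ⟨0 + 1, by omega⟩ ⟨0, by omega⟩ * t ^ (e ⟨0, by omega⟩ ⟨1, by omega⟩ + e ⟨0 + 1, by omega⟩ ⟨0, by omega⟩)) := by
    rw [h2, hL 1 (by omega), hL 0 (by omega), hMN 0 (by omega)]
  have eK3 : ctK (fun s : ℕ => if h : s < 4 then c ⟨s, h⟩ ⟨s, h⟩ * t ^ e ⟨s, h⟩ ⟨s, h⟩ else 1)
        (fun s : ℕ => -(if h : s + 1 < 4 then c ⟨s, by omega⟩ ⟨s + 1, h⟩ * t ^ e ⟨s, by omega⟩ ⟨s + 1, h⟩ else 0))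
        (fun s : ℕ => if h : 1 ≤ s ∧ s < 4 then c ⟨s, h.2⟩ ⟨s - 1, by omega⟩ * t ^ e ⟨s, h.2⟩ ⟨s - 1, by omega⟩ else 0) 3 = c ⟨2, by omega⟩ ⟨2, by omega⟩ * t ^ e ⟨2, by omega⟩ ⟨2, by omega⟩ * ctK (fun s : ℕ => if h : s < 4 then c ⟨s, h⟩ ⟨s, h⟩ * t ^ e ⟨s, h⟩ ⟨s, h⟩ else 1)
        (fun s : ℕ => -(if h : s + 1 < 4 then c ⟨s, by omega⟩ ⟨s + 1, h⟩ * t ^ e ⟨s, by omega⟩ ⟨s + 1, h⟩ else 0))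
        (fun s : ℕ => if h : 1 ≤ s ∧ s < 4 then c ⟨s, h.2⟩ ⟨s - 1, by omega⟩ * t ^ e ⟨s, h.2⟩ ⟨s - 1, by omega⟩ else 0) 2 +
      -(c ⟨1, by omega⟩ ⟨2, by omega⟩ * c ⟨1 + 1, by omega⟩ ⟨1, by omega⟩ * t ^ (e ⟨1, by omega⟩ ⟨2, by omega⟩ + e ⟨1 + 1, by omega⟩ ⟨1, by omega⟩)) *
        (c ⟨0, by omega⟩ ⟨0, by omega⟩ * t ^ e ⟨0, by omega⟩ ⟨0, by omega⟩) := by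
    rw [h3, hMN 1 (by omega), h1, hL 2 (by omega), hL 0 (by omega)]
  have eK4 : c ⟨3, by omega⟩ ⟨3, by omega⟩ * t ^ e ⟨3, by omega⟩ ⟨3, by omega⟩ * ctK (fun s : ℕ => if h : s < 4 then c ⟨s, h⟩ ⟨s, h⟩ * t ^ e ⟨s, h⟩ ⟨s, h⟩ else 1)
        (fun s : ℕ => -(if h : s + 1 < 4 then c ⟨s, by omega⟩ ⟨s + 1, h⟩ * t ^ e ⟨s, by omega⟩ ⟨s + 1, h⟩ else 0))
        (fun s : ℕ => if h : 1 ≤ s ∧ s < 4 then c ⟨s, h.2⟩ ⟨s - 1, by omega⟩ * t ^ e ⟨s, h.2⟩ ⟨s - 1, by omega⟩ else 0) 3 +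
      -(c ⟨2, by omega⟩ ⟨3, by omega⟩ * c ⟨2 + 1, by omega⟩ ⟨2, by omega⟩ * t ^ (e ⟨2, by omega⟩ ⟨3, by omega⟩ + e ⟨2 + 1, by omega⟩ ⟨2, by omega⟩)) * ctK (fun s : ℕ => if h : s < 4 then c ⟨s, h⟩ ⟨s, h⟩ * t ^ e ⟨s, h⟩ ⟨s, h⟩ else 1)
        (fun s : ℕ => -(if h : s + 1 < 4 then c ⟨s, by omega⟩ ⟨s + 1, h⟩ * t ^ e ⟨s, by omega⟩ ⟨s + 1, h⟩ else 0))
        (fun s : ℕ => if h : 1 ≤ s ∧ s < 4 then c ⟨s, h.2⟩ ⟨s - 1, by omega⟩ * t ^ e ⟨s, h.2⟩ ⟨s - 1, by omega⟩ else 0) 2 = 0 := by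
    have h4' := h4
    rw [hL 3 (by omega), hMN 2 (by omega)] at h4'
    rw [← h4']
    exact hz
  -- positivity of the diagonal monomials
  have hd0 : 0 < c ⟨0, by omega⟩ ⟨0, by omega⟩ * t ^ e ⟨0, by omega⟩ ⟨0, by omega⟩ := mul_pos (hpos _) (pow_pos ht _)
  have hd1 : 0 < c ⟨1, by omega⟩ ⟨1, by omega⟩ * t ^ e ⟨1, by omega⟩ ⟨1, by omega⟩ := mul_pos (hpos _) (pow_pos ht _)
  have hd2 : 0 < c ⟨2, by omega⟩ ⟨2, by omega⟩ * t ^ e ⟨2, by omega⟩ ⟨2, by omega⟩ := mul_pos (hpos _) (pow_pos ht _)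
  have hd3 : 0 < c ⟨3, by omega⟩ ⟨3, by omega⟩ * t ^ e ⟨3, by omega⟩ ⟨3, by omega⟩ := mul_pos (hpos _) (pow_pos ht _)
  -- the literal index forms `0 + 1`, `1 + 1`, `2 + 1` are definitionally `1`, `2`, `3`
  have e10 : c ⟨0 + 1, by omega⟩ ⟨0, by omega⟩ = c ⟨1, by omega⟩ ⟨0, by omega⟩ := rfl
  have e21 : c ⟨1 + 1, by omega⟩ ⟨1, by omega⟩ = c ⟨2, by omega⟩ ⟨1, by omega⟩ := rfl
  have e32 : c ⟨2 + 1, by omega⟩ ⟨2, by omega⟩ = c ⟨3, by omega⟩ ⟨2, by omega⟩ := rfl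
  have f10 : e ⟨0 + 1, by omega⟩ ⟨0, by omega⟩ = e ⟨1, by omega⟩ ⟨0, by omega⟩ := rfl
  have f21 : e ⟨1 + 1, by omega⟩ ⟨1, by omega⟩ = e ⟨2, by omega⟩ ⟨1, by omega⟩ := rfl
  have f32 : e ⟨2 + 1, by omega⟩ ⟨2, by omega⟩ = e ⟨3, by omega⟩ ⟨2, by omega⟩ := rfl
  rw [e10, f10] at eK2
  rw [e21, f21] at eK3
  rw [e32, f32] at eK4
  -- K2 = d0 d1 (1 − U)
  have hden01 : (c ⟨0, by omega⟩ ⟨0, by omega⟩ * c ⟨1, by omega⟩ ⟨1, by omega⟩ * t ^ (e ⟨0, by omega⟩ ⟨0, by omega⟩ + e ⟨1, by omega⟩ ⟨1, by omega⟩)) ≠ 0 := (mul_pos hd01 (pow_pos ht _)).ne'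
  have hden12 : (c ⟨1, by omega⟩ ⟨1, by omega⟩ * c ⟨2, by omega⟩ ⟨2, by omega⟩ * t ^ (e ⟨1, by omega⟩ ⟨1, by omega⟩ + e ⟨2, by omega⟩ ⟨2, by omega⟩)) ≠ 0 := (mul_pos hd12 (pow_pos ht _)).ne'
  have hden23 : (c ⟨2, by omega⟩ ⟨2, by omega⟩ * c ⟨3, by omega⟩ ⟨3, by omega⟩ * t ^ (e ⟨2, by omega⟩ ⟨2, by omega⟩ + e ⟨3, by omega⟩ ⟨3, by omega⟩)) ≠ 0 := (mul_pos hd23 (pow_pos ht _)).ne'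
  have hD01 : (c ⟨0, by omega⟩ ⟨0, by omega⟩ * t ^ e ⟨0, by omega⟩ ⟨0, by omega⟩) * (c ⟨1, by omega⟩ ⟨1, by omega⟩ * t ^ e ⟨1, by omega⟩ ⟨1, by omega⟩) = (c ⟨0, by omega⟩ ⟨0, by omega⟩ * c ⟨1, by omega⟩ ⟨1, by omega⟩ * t ^ (e ⟨0, by omega⟩ ⟨0, by omega⟩ + e ⟨1, by omega⟩ ⟨1, by omega⟩)) := by ring
  have hD23 : (c ⟨2, by omega⟩ ⟨2, by omega⟩ * t ^ e ⟨2, by omega⟩ ⟨2, by omega⟩) * (c ⟨3, by omega⟩ ⟨3, by omega⟩ * t ^ e ⟨3, by omega⟩ ⟨3, by omega⟩) = (c ⟨2, by omega⟩ ⟨2, by omega⟩ * c ⟨3, by omega⟩ ⟨3, by omega⟩ * t ^ (e ⟨2, by omega⟩ ⟨2, by omega⟩ + e ⟨3, by omega⟩ ⟨3, by omega⟩)) := by ring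
  have hK2U : ctK (fun s : ℕ => if h : s < 4 then c ⟨s, h⟩ ⟨s, h⟩ * t ^ e ⟨s, h⟩ ⟨s, h⟩ else 1)
        (fun s : ℕ => -(if h : s + 1 < 4 then c ⟨s, by omega⟩ ⟨s + 1, h⟩ * t ^ e ⟨s, by omega⟩ ⟨s + 1, h⟩ else 0))
        (fun s : ℕ => if h : 1 ≤ s ∧ s < 4 then c ⟨s, h.2⟩ ⟨s - 1, by omega⟩ * t ^ e ⟨s, h.2⟩ ⟨s - 1, by omega⟩ else 0) 2 = (c ⟨0, by omega⟩ ⟨0, by omega⟩ * t ^ e ⟨0, by omega⟩ ⟨0, by omega⟩) * (c ⟨1, by omega⟩ ⟨1, by omega⟩ * t ^ e ⟨1, by omega⟩ ⟨1, by omega⟩) * (1 - (c ⟨0, by omega⟩ ⟨1, by omega⟩ * c ⟨1, by omega⟩ ⟨0, by omega⟩) * t ^ (e ⟨0, by omega⟩ ⟨1, by omega⟩ + e ⟨1, by omega⟩ ⟨0, by omega⟩) / ((c ⟨0, by omega⟩ ⟨0, by omega⟩ * c ⟨1, by omega⟩ ⟨1, by omega⟩) * t ^ (e ⟨0, by omega⟩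 ⟨0, by omega⟩ + e ⟨1, by omega⟩ ⟨1, by omega⟩))) := by
    rw [eK2, mul_sub, mul_one, hD01, mul_div_assoc', mul_div_cancel_left₀ _ hden01]
    ring
  have h1U : 1 - (c ⟨0, by omega⟩ ⟨1, by omega⟩ * c ⟨1, by omega⟩ ⟨0, by omega⟩) * t ^ (e ⟨0, by omega⟩ ⟨1, by omega⟩ + e ⟨1, by omega⟩ ⟨0, by omega⟩) / ((c ⟨0, by omega⟩ ⟨0, by omega⟩ * c ⟨1, by omega⟩ ⟨1, by omega⟩) * t ^ (e ⟨0, by omega⟩ ⟨0, by omega⟩ + e ⟨1, by omega⟩ ⟨1, by omega⟩)) = ctK (fun s : ℕ => if h : s < 4 then c ⟨s, h⟩ ⟨s, h⟩ * t ^ e ⟨s, h⟩ ⟨s, h⟩ else 1)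
        (fun s : ℕ => -(if h : s + 1 < 4 then c ⟨s, by omega⟩ ⟨s + 1, h⟩ * t ^ e ⟨s, by omega⟩ ⟨s + 1, h⟩ else 0))
        (fun s : ℕ => if h : 1 ≤ s ∧ s < 4 then c ⟨s, h.2⟩ ⟨s - 1, by omega⟩ * t ^ e ⟨s, h.2⟩ ⟨s - 1, by omega⟩ else 0) 2 / ((c ⟨0, by omega⟩ ⟨0, by omega⟩ * t ^ e ⟨0, by omega⟩ ⟨0, by omega⟩) * (c ⟨1, by omega⟩ ⟨1, by omega⟩ * t ^ e ⟨1, by omega⟩ ⟨1, by omega⟩)) := by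
    rw [hK2U, hD01, mul_div_cancel_left₀ _ hden01]
  have h1V : 1 - (c ⟨2, by omega⟩ ⟨3, by omega⟩ * c ⟨3, by omega⟩ ⟨2, by omega⟩) * t ^ (e ⟨2, by omega⟩ ⟨3, by omega⟩ + e ⟨3, by omega⟩ ⟨2, by omega⟩) / ((c ⟨2, by omega⟩ ⟨2, by omega⟩ * c ⟨3, by omega⟩ ⟨3, by omega⟩) * t ^ (e ⟨2, by omega⟩ ⟨2, by omega⟩ + e ⟨3, by omega⟩ ⟨3, by omega⟩)) = ((c ⟨2, by omega⟩ ⟨2, by omega⟩ * t ^ e ⟨2, by omega⟩ ⟨2, by omega⟩) * (c ⟨3, by omega⟩ ⟨3, by omega⟩ * t ^ e ⟨3, by omega⟩ ⟨3, by omega⟩) - (c ⟨2, by omega⟩ ⟨3, by omega⟩ * c ⟨3, by omega⟩ ⟨2, by omega⟩ * t ^ (e ⟨2, by omega⟩ ⟨3, by omega⟩ + e ⟨3, by omega⟩ ⟨2, by omega⟩))) / ((c ⟨2, by omega⟩ ⟨2, by omega⟩ * t ^ e ⟨2, by omega⟩ ⟨2, by omega⟩) * (c ⟨3, by omega⟩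 ⟨3, by omega⟩ * t ^ e ⟨3, by omega⟩ ⟨3, by omega⟩)) := by
    rw [hD23, sub_div, div_self hden23]
  -- (★): K2 (d2 d3 − w2) = d0 d3 w1
  have star : ctK (fun s : ℕ => if h : s < 4 then c ⟨s, h⟩ ⟨s, h⟩ * t ^ e ⟨s, h⟩ ⟨s, h⟩ else 1)
        (fun s : ℕ => -(if h : s + 1 < 4 then c ⟨s, by omega⟩ ⟨s + 1, h⟩ * t ^ e ⟨s, by omega⟩ ⟨s + 1, h⟩ else 0))
        (fun s : ℕ => if h : 1 ≤ s ∧ s < 4 then c ⟨s, h.2⟩ ⟨s - 1, by omega⟩ * t ^ e ⟨s, h.2⟩ ⟨s - 1, by omega⟩ else 0) 2 * ((c ⟨2, by omega⟩ ⟨2, by omega⟩ * t ^ e ⟨2, by omega⟩ ⟨2, by omega⟩) * (c ⟨3, by omega⟩ ⟨3, by omega⟩ * t ^ e ⟨3, by omega⟩ ⟨3, by omega⟩) - (c ⟨2, by omega⟩ ⟨3, by omega⟩ * c ⟨3, by omega⟩ ⟨2, by omega⟩ * t ^ (e ⟨2, by omega⟩ ⟨3, by omega⟩ + e ⟨3,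 by omega⟩ ⟨2, by omega⟩))) = (c ⟨0, by omega⟩ ⟨0, by omega⟩ * t ^ e ⟨0, by omega⟩ ⟨0, by omega⟩) * (c ⟨3, by omega⟩ ⟨3, by omega⟩ * t ^ e ⟨3, by omega⟩ ⟨3, by omega⟩) * (c ⟨1, by omega⟩ ⟨2, by omega⟩ * c ⟨2, by omega⟩ ⟨1, by omega⟩ * t ^ (e ⟨1, by omega⟩ ⟨2, by omega⟩ + e ⟨2, by omega⟩ ⟨1, by omega⟩)) := by
    rw [eK3] at eK4
    linear_combination eK4
  refine ⟨?_, ?_, ?_, h32⟩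
  · rw [h1U, h1V, div_mul_div_comm, star, hD01, hD23, div_eq_div_iff (mul_ne_zero hden01 hden23) hden12]
    ring
  · rw [hK2U]
    constructor
    · intro h
      have := (mul_pos_iff_of_pos_left (mul_pos hd0 hd1)).mp h
      linarith
    · intro h
      exact mul_pos (mul_pos hd0 hd1) (by linarith)
  · exact (pos_and_pos_or_neg_and_neg_of_mul_pos h32).elim (fun h => h.2.ne') (fun h => h.2.ne)

/-- The positive determinant zeros with `U < 1` (normalised first link weight) of an irreducible `4 × 4` design lie in the bottom class, hence are at most two (Part 2). [this file] -/
theorem four_card_filter_U_lt_one_le_two (c : Fin 4 → Fin 4 → ℝ) (e : Fin 4 → Fin 4 → ℕ) (hc : ∀ i j, c i j = c j i)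
    (hband : ∀ i j : Fin 4, (i : ℕ) + 1 < j ∨ (j : ℕ) + 1 < i → c i j = 0) (hpos : ∀ i, 0 < c i i)
    (hirr : ∀ (k : ℕ) (hk : k + 1 < 4), c ⟨k, by omega⟩ ⟨k + 1, hk⟩ ≠ 0) :
    (((Matrix.det (Matrix.of fun i j => C (c i j) * (X : ℝ[X]) ^ e i j)).roots.toFinset.filter
      (fun t : ℝ => 0 < t)).filter (fun t : ℝ => (c ⟨0, by omega⟩ ⟨1, by omega⟩ * c ⟨1, by omega⟩ ⟨0, by omega⟩) * t ^ (e ⟨0, by omega⟩ ⟨1, by omega⟩ + e ⟨1, by omega⟩ ⟨0, by omega⟩) / ((c ⟨0, by omega⟩ ⟨0, by omega⟩ * c ⟨1, by omega⟩ ⟨1, by omega⟩) * t ^ (e ⟨0, by omega⟩ ⟨0, by omega⟩ + e ⟨1, by omega⟩ ⟨1, by omega⟩)) < 1)).card ≤ 2 := by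
  set P : ℝ[X] := Matrix.det (Matrix.of fun i j => C (c i j) * (X : ℝ[X]) ^ e i j) with hP
  have hmem : ∀ t ∈ P.roots.toFinset.filter (fun t : ℝ => 0 < t), 0 < t ∧ P.IsRoot t := by
    intro t ht
    rw [Finset.mem_filter, Multiset.mem_toFinset, Polynomial.mem_roots'] at ht
    exact ⟨ht.2, ht.1.2⟩
  refine le_trans (Finset.card_le_card ?_) (card_posRoots_bottomClass_le_two c e hc hband hpos)
  intro t ht
  have ht' := ht
  rw [Finset.mem_filter] at ht'
  obtain ⟨htP, hU1⟩ := ht'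
  obtain ⟨ht0, hr⟩ := hmem t htP
  obtain ⟨-, hclass, hK2ne, h32⟩ := four_root_facts c e hc hband hpos hirr ht0 hr
  have h2 := hclass.mpr hU1
  have h3 : 0 < ctK (fun s : ℕ => if h : s < 4 then c ⟨s, h⟩ ⟨s, h⟩ * t ^ e ⟨s, h⟩ ⟨s, h⟩ else 1)
        (fun s : ℕ => -(if h : s + 1 < 4 then c ⟨s, by omega⟩ ⟨s + 1, h⟩ * t ^ e ⟨s, by omega⟩ ⟨s + 1, h⟩ else 0))
        (fun s : ℕ => if h : 1 ≤ s ∧ s < 4 then c ⟨s, h.2⟩ ⟨s - 1, by omega⟩ * t ^ e ⟨s, h.2⟩ ⟨s - 1, by omega⟩ else 0) 3 := by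
    rcases pos_and_pos_or_neg_and_neg_of_mul_pos h32 with ⟨h3, -⟩ | ⟨-, h2'⟩
    · exact h3
    · exact absurd h2 (not_lt.mpr h2'.le)
  have h1 : 0 < ctK (fun s : ℕ => if h : s < 4 then c ⟨s, h⟩ ⟨s, h⟩ * t ^ e ⟨s, h⟩ ⟨s, h⟩ else 1)
        (fun s : ℕ => -(if h : s + 1 < 4 then c ⟨s, by omega⟩ ⟨s + 1, h⟩ * t ^ e ⟨s, by omega⟩ ⟨s + 1, h⟩ else 0))
        (fun s : ℕ => if h : 1 ≤ s ∧ s < 4 then c ⟨s, h.2⟩ ⟨s - 1, by omega⟩ * t ^ e ⟨s, h.2⟩ ⟨s - 1, by omega⟩ else 0) 1 := by rw [ctK_one]; exact diagSeq_pos c e hpos ht0 0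
  have htP' : t ∈ P.roots.toFinset := (Finset.mem_filter.mp htP).1
  rw [Finset.mem_filter]
  refine ⟨htP', ht0, fun k hk => ?_⟩
  rw [det_leadingBlock_eq_ctK c e hband t hk.le]
  interval_cases k
  · rw [ctK_zero]; exact one_pos
  · exact h1
  · exact h2
  · exact h3

/-- The positive determinant zeros with `U > 1` of an irreducible `4 × 4` design lie in the top class, hence are at most two (Part 3b). [this file] -/
theorem four_card_filter_one_lt_U_le_two (c : Fin 4 → Fin 4 → ℝ) (e : Fin 4 → Fin 4 → ℕ) (hc : ∀ i j, c i j = c j i)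
    (hband : ∀ i j : Fin 4, (i : ℕ) + 1 < j ∨ (j : ℕ) + 1 < i → c i j = 0) (hpos : ∀ i, 0 < c i i)
    (hirr : ∀ (k : ℕ) (hk : k + 1 < 4), c ⟨k, by omega⟩ ⟨k + 1, hk⟩ ≠ 0) :
    (((Matrix.det (Matrix.of fun i j => C (c i j) * (X : ℝ[X]) ^ e i j)).roots.toFinset.filter
      (fun t : ℝ => 0 < t)).filter (fun t : ℝ => 1 < (c ⟨0, by omega⟩ ⟨1, by omega⟩ * c ⟨1, by omega⟩ ⟨0, by omega⟩) * t ^ (e ⟨0, by omega⟩ ⟨1, by omega⟩ + e ⟨1, by omega⟩ ⟨0, by omega⟩) / ((c ⟨0, by omega⟩ ⟨0, by omega⟩ * c ⟨1, by omega⟩ ⟨1, by omega⟩) * t ^ (e ⟨0, by omega⟩ ⟨0, by omega⟩ + e ⟨1, by omega⟩ ⟨1, by omega⟩)))).card ≤ 2 := by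
  set P : ℝ[X] := Matrix.det (Matrix.of fun i j => C (c i j) * (X : ℝ[X]) ^ e i j) with hP
  have hmem : ∀ t ∈ P.roots.toFinset.filter (fun t : ℝ => 0 < t), 0 < t ∧ P.IsRoot t := by
    intro t ht
    rw [Finset.mem_filter, Multiset.mem_toFinset, Polynomial.mem_roots'] at ht
    exact ⟨ht.2, ht.1.2⟩
  refine le_trans (Finset.card_le_card ?_) (card_posRoots_topClass_le_two c e ⟨2, rfl⟩ hc hband hpos)
  intro t ht
  have ht' := ht
  rw [Finset.mem_filter] at ht'
  obtain ⟨htP, hU1⟩ := ht'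
  obtain ⟨ht0, hr⟩ := hmem t htP
  obtain ⟨-, hclass, hK2ne, h32⟩ := four_root_facts c e hc hband hpos hirr ht0 hr
  have h2 : ctK (fun s : ℕ => if h : s < 4 then c ⟨s, h⟩ ⟨s, h⟩ * t ^ e ⟨s, h⟩ ⟨s, h⟩ else 1)
        (fun s : ℕ => -(if h : s + 1 < 4 then c ⟨s, by omega⟩ ⟨s + 1, h⟩ * t ^ e ⟨s, by omega⟩ ⟨s + 1, h⟩ else 0))
        (fun s : ℕ => if h : 1 ≤ s ∧ s < 4 then c ⟨s, h.2⟩ ⟨s - 1, by omega⟩ * t ^ e ⟨s, h.2⟩ ⟨s - 1, by omega⟩ else 0) 2 < 0 := by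
    rcases lt_trichotomy (ctK (fun s : ℕ => if h : s < 4 then c ⟨s, h⟩ ⟨s, h⟩ * t ^ e ⟨s, h⟩ ⟨s, h⟩ else 1)
        (fun s : ℕ => -(if h : s + 1 < 4 then c ⟨s, by omega⟩ ⟨s + 1, h⟩ * t ^ e ⟨s, by omega⟩ ⟨s + 1, h⟩ else 0))
        (fun s : ℕ => if h : 1 ≤ s ∧ s < 4 then c ⟨s, h.2⟩ ⟨s - 1, by omega⟩ * t ^ e ⟨s, h.2⟩ ⟨s - 1, by omega⟩ else 0) 2) 0 with h | h | h
    · exact h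
    · exact absurd h hK2ne
    · exact absurd (hclass.mp h) (not_lt.mpr hU1.le)
  have h3 : ctK (fun s : ℕ => if h : s < 4 then c ⟨s, h⟩ ⟨s, h⟩ * t ^ e ⟨s, h⟩ ⟨s, h⟩ else 1)
        (fun s : ℕ => -(if h : s + 1 < 4 then c ⟨s, by omega⟩ ⟨s + 1, h⟩ * t ^ e ⟨s, by omega⟩ ⟨s + 1, h⟩ else 0))
        (fun s : ℕ => if h : 1 ≤ s ∧ s < 4 then c ⟨s, h.2⟩ ⟨s - 1, by omega⟩ * t ^ e ⟨s, h.2⟩ ⟨s - 1, by omega⟩ else 0) 3 < 0 := by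
    rcases pos_and_pos_or_neg_and_neg_of_mul_pos h32 with ⟨-, h2'⟩ | ⟨h3, -⟩
    · exact absurd h2 (not_lt.mpr h2'.le)
    · exact h3
  have h1 : 0 < ctK (fun s : ℕ => if h : s < 4 then c ⟨s, h⟩ ⟨s, h⟩ * t ^ e ⟨s, h⟩ ⟨s, h⟩ else 1)
        (fun s : ℕ => -(if h : s + 1 < 4 then c ⟨s, by omega⟩ ⟨s + 1, h⟩ * t ^ e ⟨s, by omega⟩ ⟨s + 1, h⟩ else 0))
        (fun s : ℕ => if h : 1 ≤ s ∧ s < 4 then c ⟨s, h.2⟩ ⟨s - 1, by omega⟩ * t ^ e ⟨s, h.2⟩ ⟨s - 1, by omega⟩ else 0) 1 := by rw [ctK_one]; exact diagSeq_pos c e hpos ht0 0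
  have htP' : t ∈ P.roots.toFinset := (Finset.mem_filter.mp htP).1
  rw [Finset.mem_filter]
  refine ⟨htP', ht0, fun k hk => ?_⟩
  rw [det_leadingBlock_eq_ctK c e hband t hk.le]
  interval_cases k
  · rw [ctK_zero]; norm_num
  · simpa using h1
  · show 0 < (-1 : ℝ) ^ 1 * _
    rw [pow_one]; linarith
  · show 0 < (-1 : ℝ) ^ 1 * _
    rw [pow_one]; linarith


end Summit.ValiantsHypothesis.ValiantsHypothesis.Theorems.KPlusLogSqLaw.DefiniteInterpolation
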